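import Literature.NumberTheory.ModularForms.Lemma49Minus8G
import Literature.NumberTheory.ModularForms.KernelBounds24Plus
import HarnessLib

/-!
# Tools for CKMRV Lemma 4.9 in dimension 24: `q`-heads of `j`, `E₁₄/Δ`, `E₁₀/Δ`

Cohn–Kumar–Miller–Radchenko–Viazovska, arXiv:1902.05438, §4.4 (4.13) and Lemma 4.9: the `d = 24`
kernels contain `j(τ) − j(z)`, `E₁₄/Δ` and `E₁₀/Δ`, whose expansions at `i∞` start with `q⁻¹`.
PROVED here: `q·(E₁₄/Δ) − 1 = O(q²)`, `q·(E₁₀/Δ) − 1 + 240q = O(q²)` (complementing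
`qj − 1 − 744q = O(q²)` of `QAsymptotics3`), division-by-`q` lemmas for `O`-statements, continuity and
`2`-periodicity of `j, E₁₄/Δ, E₁₀/Δ`, and the conversion of `O`-statements at `i∞` for continuous
`2`-periodic functions into `O`-statements along the principal filter of a half-plane.

## References

* H. Cohn, A. Kumar, S. D. Miller, D. Radchenko, M. Viazovska, Ann. of Math. 196 (2022),
  arXiv:1902.05438, §2.1, §4.4, Lemma 4.9. [CohnEtAl2019]
-/

noncomputable section

open Complex hiding I
open Filter Topology Asymptotics ModularForm SlashInvariantForm EisensteinSeries
open UpperHalfPlane hiding I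
open Complex (I)
open scoped Real MatrixGroups ModularForm Manifold

namespace Literature.NumberTheory.ModularForms

open Literature.NumberTheory.EllipticCurves.ModularForms (kleinJ kleinJ_smul continuous_kleinJ E₄_cube_eq_kleinJ_mul)

/-! ## Continuity and periodicity -/

/-- `continuous_E₄'` (auxiliary). [cite: CohnEtAl2019, Lemma 4.9 (proof)] -/
@[fun_prop] theorem continuous_E₄' : Continuous (⇑E₄ : ℍ → ℂ) := E₄.holo'.continuous
/-- `continuous_E₆'` (auxiliary). [cite: CohnEtAl2019, Lemma 4.9 (proof)] -/
@[fun_prop] theorem continuous_E₆' : Continuous (⇑E₆ : ℍ → ℂ) := E₆.holo'.continuous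

/-- `continuous_E14fun` (auxiliary). [cite: CohnEtAl2019, Lemma 4.9 (proof)] -/
@[fun_prop] theorem continuous_E14fun : Continuous E14fun := by unfold E14fun; fun_prop
/-- `continuous_E10fun` (auxiliary). [cite: CohnEtAl2019, Lemma 4.9 (proof)] -/
@[fun_prop] theorem continuous_E10fun : Continuous E10fun := by unfold E10fun; fun_prop
/-- `continuous_E8fun` (auxiliary). [cite: CohnEtAl2019, Lemma 4.9 (proof)] -/
@[fun_prop] theorem continuous_E8fun : Continuous E8fun := by unfold E8fun; fun_prop

/-- `continuous_discriminant_inv` (auxiliary). [cite: CohnEtAl2019, Lemma 4.9 (proof)] -/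
@[fun_prop] theorem continuous_discriminant_inv : Continuous (ModularForm.discriminant⁻¹ : ℍ → ℂ) :=
  Continuous.inv₀ continuous_discriminant' ModularForm.discriminant_ne_zero

/-- `continuous_f2fun` (auxiliary). [cite: CohnEtAl2019, Lemma 4.9 (proof)] -/
@[fun_prop] theorem continuous_f2fun : Continuous f2fun := by unfold f2fun; fun_prop
/-- `continuous_fNeg2fun` (auxiliary). [cite: CohnEtAl2019, Lemma 4.9 (proof)] -/
@[fun_prop] theorem continuous_fNeg2fun : Continuous fNeg2fun := by unfold fNeg2fun; fun_prop
attribute [fun_prop] Literature.NumberTheory.EllipticCurves.ModularForms.continuous_kleinJ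

/-- `E₄_vadd_two` (auxiliary). [cite: CohnEtAl2019, Lemma 4.9 (proof)] -/
theorem E₄_vadd_two (τ : ℍ) : E₄ ((2 : ℝ) +ᵥ τ) = E₄ τ := levelOne_vadd_two E₄ τ
/-- `E₆_vadd_two` (auxiliary). [cite: CohnEtAl2019, Lemma 4.9 (proof)] -/
theorem E₆_vadd_two (τ : ℍ) : E₆ ((2 : ℝ) +ᵥ τ) = E₆ τ := levelOne_vadd_two E₆ τ
/-- `E14fun_vadd_two` (auxiliary). [cite: CohnEtAl2019, Lemma 4.9 (proof)] -/
theorem E14fun_vadd_two (τ : ℍ) : E14fun ((2 : ℝ) +ᵥ τ) = E14fun τ := by simp [E14fun, E₄_vadd_two, E₆_vadd_two]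
/-- `E10fun_vadd_two` (auxiliary). [cite: CohnEtAl2019, Lemma 4.9 (proof)] -/
theorem E10fun_vadd_two (τ : ℍ) : E10fun ((2 : ℝ) +ᵥ τ) = E10fun τ := by simp [E10fun, E₄_vadd_two, E₆_vadd_two]
/-- `E8fun_vadd_two` (auxiliary). [cite: CohnEtAl2019, Lemma 4.9 (proof)] -/
theorem E8fun_vadd_two (τ : ℍ) : E8fun ((2 : ℝ) +ᵥ τ) = E8fun τ := by simp [E8fun, E₄_vadd_two]
/-- `f2fun_vadd_two` (auxiliary). [cite: CohnEtAl2019, Lemma 4.9 (proof)] -/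
theorem f2fun_vadd_two (τ : ℍ) : f2fun ((2 : ℝ) +ᵥ τ) = f2fun τ := by
  simp [f2fun, E14fun_vadd_two, discriminant_vadd_two]
/-- `fNeg2fun_vadd_two` (auxiliary). [cite: CohnEtAl2019, Lemma 4.9 (proof)] -/
theorem fNeg2fun_vadd_two (τ : ℍ) : fNeg2fun ((2 : ℝ) +ᵥ τ) = fNeg2fun τ := by
  simp [fNeg2fun, E10fun_vadd_two, discriminant_vadd_two]
/-- `kleinJ_vadd_two` (auxiliary). [cite: CohnEtAl2019, Lemma 4.9 (proof)] -/
theorem kleinJ_vadd_two (τ : ℍ) : kleinJ ((2 : ℝ) +ᵥ τ) = kleinJ τ := by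
  have h1 := E₄_cube_eq_kleinJ_mul ((2 : ℝ) +ᵥ τ)
  rw [E₄_vadd_two, discriminant_vadd_two, E₄_cube_eq_kleinJ_mul τ] at h1
  exact (mul_right_cancel₀ (ModularForm.discriminant_ne_zero τ) h1).symm

/-! ## Division by `q` in `O`-statements -/

/-- `qfun_ne_zero` (auxiliary). [cite: CohnEtAl2019, Lemma 4.9 (proof)] -/
theorem qfun_ne_zero (τ : ℍ) : qfun τ ≠ 0 := Complex.exp_ne_zero _

/-- If `qF = O(q^{m+1})` at `i∞` then `F = O(q^m)`. [folklore] -/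
theorem isBigO_of_qfun_mul {F : ℍ → ℂ} {m : ℕ}
    (h : (fun τ => qfun τ * F τ) =O[atImInfty] fun τ => expDecay τ ^ (m + 1)) :
    F =O[atImInfty] fun τ => expDecay τ ^ m := by
  obtain ⟨C, hC⟩ := h.bound
  refine IsBigO.of_bound C (hC.mono fun τ hτ => ?_)
  have hq : 0 < expDecay τ := expDecay_pos τ
  rw [norm_mul, norm_qfun, Real.norm_of_nonneg (pow_nonneg hq.le _), pow_succ] at hτ
  rw [Real.norm_of_nonneg (pow_nonneg hq.le _)]
  nlinarith [norm_nonneg (F τ), pow_nonneg hq.le m]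

/-- If `q^{1/2}F = O(q^{(m+1)/2})` at `i∞` then `F = O(q^{m/2})`. [folklore] -/
theorem isBigO_of_qhalf_mul {F : ℍ → ℂ} {m : ℕ}
    (h : (fun τ => qhalf τ * F τ) =O[atImInfty] fun τ => expDecayHalf τ ^ (m + 1)) :
    F =O[atImInfty] fun τ => expDecayHalf τ ^ m := by
  obtain ⟨C, hC⟩ := h.bound
  refine IsBigO.of_bound C (hC.mono fun τ hτ => ?_)
  have hq : 0 < expDecayHalf τ := expDecayHalf_pos τ
  rw [norm_mul, norm_qhalf, Real.norm_of_nonneg (pow_nonneg hq.le _), pow_succ] at hτ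
  rw [Real.norm_of_nonneg (pow_nonneg hq.le _)]
  nlinarith [norm_nonneg (F τ), pow_nonneg hq.le m]

/-- A function tending to `1` has eventually bounded inverse. [folklore] -/
theorem isBigO_inv_one_of_tendsto_one {P : ℍ → ℂ} (hP : Tendsto P atImInfty (𝓝 1)) :
    (fun τ => (P τ)⁻¹) =O[atImInfty] fun _ : ℍ => (1 : ℝ) := by
  have hev : ∀ᶠ τ : ℍ in atImInfty, 1 / 2 ≤ ‖P τ‖ := by
    have := (continuous_norm.tendsto (1 : ℂ)).comp hP
    rw [norm_one] at this
    exact this.eventually (eventually_ge_nhds (by norm_num : (1 / 2 : ℝ) < 1))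
  refine IsBigO.of_bound 2 (hev.mono fun τ hτ => ?_)
  rw [norm_inv, norm_one, mul_one]
  have hpos : 0 < ‖P τ‖ := lt_of_lt_of_le (by norm_num) hτ
  rw [inv_le_comm₀ hpos (by norm_num)]
  linarith

/-! ## `Δ/q`, `q·E₁₄/Δ`, `q·E₁₀/Δ` -/

/-- `P = Δ/q → 1` and `P − 1 + 24q = O(q²)`. [cite: CohnEtAl2019, §2.1.1] -/
theorem discriminant_div_q :
    Tendsto (fun τ : ℍ => ModularForm.discriminant τ * (qfun τ)⁻¹) atImInfty (𝓝 1) ∧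
    ((fun τ : ℍ => ModularForm.discriminant τ * (qfun τ)⁻¹ - 1 + 24 * qfun τ) =O[atImInfty] fun τ => expDecay τ ^ 2) := by
  refine ⟨?_, ?_⟩
  · refine tendsto_exp_mul_discriminant.congr fun τ => ?_
    rw [qfun, Complex.exp_neg]; ring
  · refine isBigO_of_qfun_mul ?_
    have := discriminant_third_order
    refine this.congr_left fun τ => ?_
    have hq := qfun_ne_zero τ
    field_simp

/-- **`q·(E₁₄/Δ) − 1 = O(q²)`** (the `q¹`-coefficient vanishes: `(1 − 24q)(1 + 24q) = 1 + O(q²)`).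
[cite: CohnEtAl2019, §2.1.1] -/
theorem qfun_mul_f2fun_second_order :
    (fun τ : ℍ => qfun τ * f2fun τ - 1) =O[atImInfty] fun τ => expDecay τ ^ 2 := by
  obtain ⟨hP, hP2⟩ := discriminant_div_q
  obtain ⟨h14, _, _⟩ := E14_E4cube_E10_second_order
  have hPinv := isBigO_inv_one_of_tendsto_one hP
  -- `qf₂ − 1 = (E₁₄ − P)/P`, `E₁₄ − P = (E₁₄ − 1 + 24q) − (P − 1 + 24q)`
  have hnum : (fun τ : ℍ => E14fun τ - ModularForm.discriminant τ * (qfun τ)⁻¹) =O[atImInfty] fun τ => expDecay τ ^ 2 :=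
    (h14.sub hP2).congr_left fun τ => by ring
  have := hnum.mul hPinv
  refine (this.congr_right fun τ => mul_one _).congr_left fun τ => ?_
  have hq := qfun_ne_zero τ
  have hΔ := ModularForm.discriminant_ne_zero τ
  simp only [f2fun, Pi.mul_apply, Pi.inv_apply]
  field_simp

/-- **`q·(E₁₀/Δ) − 1 + 240q = O(q²)`**. [cite: CohnEtAl2019, §2.1.1] -/
theorem qfun_mul_fNeg2fun_second_order :
    (fun τ : ℍ => qfun τ * fNeg2fun τ - 1 + 240 * qfun τ) =O[atImInfty] fun τ => expDecay τ ^ 2 := by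
  obtain ⟨hP, hP2⟩ := discriminant_div_q
  obtain ⟨_, _, h10⟩ := E14_E4cube_E10_second_order
  have hPinv := isBigO_inv_one_of_tendsto_one hP
  have hq1 : (fun τ => qfun τ) =O[atImInfty] fun _ : ℍ => (1 : ℝ) := qfun_isBigO_one
  have e21 : (fun τ => expDecay τ ^ 2) =O[atImInfty] expDecay :=
    IsBigO.of_bound 1 (Eventually.of_forall fun τ => by
      rw [Real.norm_of_nonneg (sq_nonneg _), Real.norm_of_nonneg (expDecay_pos τ).le, one_mul, sq]
      exact mul_le_of_le_one_left (expDecay_pos τ).le (expDecay_le_one τ))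
  have hP1 : (fun τ : ℍ => ModularForm.discriminant τ * (qfun τ)⁻¹ - 1) =O[atImInfty] expDecay := by
    have := (hP2.trans e21).sub (qfun_isBigO.const_mul_left 24)
    exact this.congr_left fun τ => by ring
  -- numerator `E₁₀ − P + 240qP = (E₁₀ − 1 + 264q) − (P − 1 + 24q) + 240q(P − 1)`
  have hnum : (fun τ : ℍ => E10fun τ - ModularForm.discriminant τ * (qfun τ)⁻¹ +
      240 * qfun τ * (ModularForm.discriminant τ * (qfun τ)⁻¹)) =O[atImInfty] fun τ => expDecay τ ^ 2 := by
    have t3 : (fun τ : ℍ => 240 * qfun τ * (ModularForm.discriminant τ * (qfun τ)⁻¹ - 1)) =O[atImInfty] fun τ => expDecay τ ^ 2 := by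
      have := (qfun_isBigO.mul hP1).const_mul_left 240
      refine (this.congr_left fun τ => by ring).congr_right fun τ => by ring
    exact ((h10.sub hP2).add t3).congr_left fun τ => by ring
  have := hnum.mul hPinv
  refine (this.congr_right fun τ => mul_one _).congr_left fun τ => ?_
  have hq := qfun_ne_zero τ
  have hΔ := ModularForm.discriminant_ne_zero τ
  simp only [fNeg2fun, Pi.mul_apply, Pi.inv_apply]
  field_simp

/-! ## From `i∞` to half-planes for `2`-periodic continuous functions -/

/-- `O(q^m)` at `i∞` for a continuous `2`-periodic function gives `O(q^m)` along `𝓟 {Im ≥ δ}`. [folklore] -/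
theorem isBigO_halfPlane_of_two_periodic {G : ℍ → ℂ} (hc : Continuous G) (hper : ∀ τ : ℍ, G ((2 : ℝ) +ᵥ τ) = G τ)
    (m : ℕ) (hO : G =O[atImInfty] fun τ => expDecay τ ^ m) {δ : ℝ} (hδ : 0 < δ) :
    G =O[𝓟 (halfPlane δ)] fun τ => expDecay τ ^ m := by
  have hO' : G =O[atImInfty] fun τ => expDecayHalf τ ^ (2 * m) := hO.congr_right fun τ => expDecay_pow_eq τ m
  obtain ⟨C, hC⟩ := uniform_of_two_periodic hc hper (2 * m) hO' hδ
  rw [isBigO_principal]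
  refine ⟨C, fun τ hτ => ?_⟩
  rw [Real.norm_of_nonneg (pow_nonneg (expDecay_pos τ).le m), expDecay_pow_eq]
  exact hC τ hτ

/-- Half-integral version. [folklore] -/
theorem isBigO_halfPlane_of_two_periodic_half {G : ℍ → ℂ} (hc : Continuous G) (hper : ∀ τ : ℍ, G ((2 : ℝ) +ᵥ τ) = G τ)
    (m : ℕ) (hO : G =O[atImInfty] fun τ => expDecayHalf τ ^ m) {δ : ℝ} (hδ : 0 < δ) :
    G =O[𝓟 (halfPlane δ)] fun τ => expDecayHalf τ ^ m := by
  obtain ⟨C, hC⟩ := uniform_of_two_periodic hc hper m hO hδ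
  rw [isBigO_principal]
  refine ⟨C, fun τ hτ => ?_⟩
  rw [Real.norm_of_nonneg (pow_nonneg (expDecayHalf_pos τ).le m)]
  exact hC τ hτ

end Literature.NumberTheory.ModularForms
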